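import Literature.NumberTheory.IwasawaTheory.Greenberg2006.LocalH2VanishingOfLOC1
import HarnessLib

/-!
# Greenberg 2006 §5 A, converse direction: `H²(K_v, 𝒟) = 0 ⟹ LOC_v⁽¹⁾(𝒟)` (local Tate duality in
# the limit, the other half of "`H²(K_v, 𝒟)` is dual to `(T*)^{G_{K_v}}`") — theorems only

R. Greenberg, *On the structure of certain Galois cohomology groups*, Doc. Math. Extra Vol. Coates
(2006), §5 A (p. 372 L93 – p. 373 L10): for a non-archimedean prime `v` and a discrete `p`-primary
`Γ_{K_v}`-module `𝒟`, "the Pontryagin dual of `(T*)^{G_{K_v}} = H⁰(K_v, T*)` is `H²(K_v, 𝒟)`",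
`T* = Hom(𝒟, μ_{p^∞})`. The sibling file `LocalH2VanishingOfLOC1.lean` proves the consumed implication
LOC_v⁽¹⁾(𝒟) ⟹ `H²(K_v, 𝒟) = 0`; THIS file proves the converse: if `H²(K_v, 𝒟) = 0` then every additive
`𝒟 → K̄ˣ` equivariant for `Γ_{K_v} → Γ_K` vanishes (`Greenberg2016.LOC1`). Together they say that
LOC_v⁽¹⁾ is EQUIVALENT to `H²(K_v, 𝒟) = 0` — the form in which [Greenberg2016Selmer] §4.1 (p. 16 L33–34,
"one sees easily that if LOC_η⁽¹⁾(𝐃) holds, then so does LOC_η⁽¹⁾(𝐃[Π])", via [Gr4] Remark 3.5.1)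
transfers LOC_η⁽¹⁾ from `𝐃` to `𝐃[π]`: `H²(K_η, 𝐃[π]) = H¹(K_η, 𝐃)/π = 0` for almost all `π` once
`H¹(K_η, 𝐃)` is almost divisible (Prop. 4.2.2, proved in the tree).

PROOF (finite levels, no passage to the limit of the dualities needed). Work over `ℤ`. Let
`h : 𝒟 → K̄ˣ` be equivariant and `a ∈ 𝒟`; let `W` be the finite stable submodule generated by `a`
(`genSubmodule`). Every class of the finite group `H²(Γ, W)` dies in `H²(Γ, 𝒟) = 0`, hence — a
continuous bounding `1`-cochain takes finitely many values — in `H²(Γ, W_z)` for a finite stable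
`W_z ⊇ W` (`exists_level_twoCocycleClass_eq_zero`); so `H²(Γ, W) → H²(Γ, W')` is ZERO for the finite
stable `W' ⊇ W` generated by the `W_z`. Let `p^k` kill `W'`. Transport `h|_{W'}` and `h|_W` to
invariant elements `f'`, `f` of `Hom(W', μ_{p^k}(K̄_v))`, `Hom(W, μ_{p^k}(K̄_v))` (`exists_homCarrier_of_equivariant`).
By local Tate duality in bidegree `(2, 0)` at the finite level `W` in its RIGHT-separating form
(`ContinuousRep.exists_cohomologyMap_two_ne_zero_of_ne_zero`: the map `f ↦ ⟨·, f⟩` from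
`Hom_Γ(W, μ_{p^k})` onto `Hom(H²(Γ, W), ℤ/p^k)` — `twoZero_surjective_local` — is a surjection between
finite sets of the same cardinality `|H²(Γ, W)|` — `natCard_two_eq_natCard_invariants_homRep`,
`Nat.card_addMonoidHom_zmod` — hence injective), `f ≠ 0` would give `z ∈ H²(Γ, W)` with
`H²(ev_f) z ≠ 0`; but `H²(ev_f) z = H²(ev_{f'}) (H²(W ⊆ W') z) = H²(ev_{f'}) 0 = 0`. So `f = 0`, i.e.
`h a = 1`.

* §1 `exists_level_twoCocycleClass_eq_zero` — colimit injectivity of `H²` on finite levels;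
* §2 `ContinuousRep.exists_cohomologyMap_two_ne_zero_of_ne_zero` — right separation at a finite level;
* §3 `equivariantHom_eq_zero_of_subsingleton_H_two` — the converse over `ℤ` for a local field `F/K`;
* §4 `loc1_of_subsingleton_localH2` — the Greenberg-typed statement: `H²(K_v, 𝒟) = 0 → LOC_v⁽¹⁾(𝒟)`
  for the tree's `localRep`, any coefficient ring `Λ`, any discrete `p`-primary `𝒟`.

HONESTY. Nothing here proves a summit statement; BSD is not advanced. Seat `bsd-input-gr16-prop411`
(literature-prover, 2026-08-28): this is the "local duality in the limit" half of transfer (T7(c)(i))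
of the input (γ) of `Greenberg2016.prop411_selmer_isAlmostDivisible_of_facts'`. AI-typed,
kernel-checked.

## References
* [Greenberg2006] R. Greenberg, Doc. Math. Extra Vol. Coates (2006) 335–391, §5 A (pp. 372–373).
* [Greenberg2016Selmer] R. Greenberg, *On the structure of Selmer groups* (2016), §4.1 p. 16 L33–34.
* [SerreGaloisCohomology1997] J.-P. Serre, *Galois Cohomology* (1997), I §2.2 Cor. 2; II §5.2 Thm. 2.
* [MilneADT2006] J. S. Milne, *Arithmetic Duality Theorems* (2006), I Cor. 2.3.
-/

noncomputable section

open scoped Classical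
open CategoryTheory Function NumberField IsDedekindDomain Field
open Literature.NumberTheory.GaloisRepresentations
open Literature.NumberTheory.GaloisRepresentations.DiscreteGaloisModule
open Literature.NumberTheory.IwasawaTheory.Greenberg2016
open _root_.TopRep _root_.ContRepresentation _root_.ContinuousCohomology

universe u

namespace Literature.NumberTheory.IwasawaTheory.Greenberg2006

/-! ### §1. Colimit injectivity: a class of a finite level dying in `𝒟` dies in a finite level -/

section Levels

variable {Γ : Type u} [Group Γ] [TopologicalSpace Γ] [IsTopologicalGroup Γ] [CompactSpace Γ]
variable {M : Type u} [AddCommGroup M] [TopologicalSpace M] [DiscreteTopology M]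
variable (ρ : ContinuousRep Γ ℤ M)

/-- **`H²(Γ, 𝒟) = lim→ H²(Γ, W)` is injective on the colimit side**: if the class of a `2`-cocycle `c₁`
of a finite stable level `W₁` dies in `H²(Γ, 𝒟)`, it dies in `H²(Γ, W)` for some FINITE stable
`W ⊇ W₁` (the level generated by `W₁` and the finitely many values of a continuous bounding
`1`-cochain). [cite: SerreGaloisCohomology1997, I §2.2 Cor. 2] -/
theorem exists_level_twoCocycleClass_eq_zero {p : ℕ} (hp : p ≠ 0) (hM : IsPrimaryTorsion p M)
    {W₁ : Submodule ℤ M} (hW₁ : ∀ g, W₁ ≤ W₁.comap (ρ g)) (hfin₁ : (W₁ : Set M).Finite)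
    (c₁ : contTwoCocycles (ρ.subrepresentation W₁ hW₁).toTopRep)
    (h0 : cohomologyMap (subtypeHom ρ W₁ hW₁) 2 (twoCocycleClass _ c₁) = 0) :
    ∃ (W : Submodule ℤ M) (hW : ∀ g, W ≤ W.comap (ρ g)) (_ : W₁ ≤ W)
      (c : contTwoCocycles (ρ.subrepresentation W hW).toTopRep),
      Finite W ∧ (∀ x, (c.1 x : M) = c₁.1 x) ∧ twoCocycleClass _ c = 0 := by
  rw [cohomologyMap_twoCocycleClass, twoCocycleClass_eq_zero_iff] at h0
  obtain ⟨b, hb⟩ := h0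
  have hbfin : (Set.range b).Finite := (isCompact_range b.continuous).finite_of_discrete
  let W : Submodule ℤ M := genSubmodule ρ ((W₁ : Set M) ∪ Set.range b)
  have hW : ∀ g, W ≤ W.comap (ρ g) := genSubmodule_le_comap ρ _
  have hle : W₁ ≤ W := fun x hx ↦ subset_genSubmodule ρ _ (Set.mem_union_left _ hx)
  have hbW : ∀ σ, b σ ∈ W := fun σ ↦ subset_genSubmodule ρ _ (Set.mem_union_right _ ⟨σ, rfl⟩)
  haveI hWfin : Finite W := finite_genSubmodule ρ hp hM (hfin₁.union hbfin)
  -- the cocycle `c₁` read in `M`, and co-restricted to `W`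
  let c₀ : contTwoCocycles ρ.toTopRep :=
    contTwoCocycles.pullback (ContinuousMonoidHom.id Γ) (resIdHom (subtypeHom ρ W₁ hW₁)) c₁
  have hc₀ : ∀ x, c₀.1 x = (c₁.1 x : M) := fun x ↦ by
    obtain ⟨σ, τ⟩ := x
    rw [pullback₂_id_resIdHom_apply, subtypeHom_hom_apply]
  obtain ⟨c, hc⟩ := contTwoCocycles.exists_codRestrict ρ c₀ W hW fun x ↦ by
    rw [hc₀]; exact hle (c₁.1 x).2
  refine ⟨W, hW, hle, c, hWfin, fun x ↦ (hc x).trans (hc₀ x), ?_⟩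
  rw [twoCocycleClass_eq_zero_iff]
  refine ⟨⟨fun σ ↦ ⟨b σ, hbW σ⟩, b.continuous.subtype_mk _⟩, fun σ τ ↦ Subtype.ext ?_⟩
  have h1 := hb σ τ
  rw [hc₀] at h1
  simp only [Submodule.coe_add, Submodule.coe_sub, ContinuousMap.coe_mk, hc]
  rw [hc₀]
  exact h1

end Levels

/-! ### §2. Local Tate duality `(2, 0)` at a finite level: the pairing separates `Hom_Γ(M, μ)` -/

section Separation

variable (F : Type u) [Field F] [ValuativeRel F] [TopologicalSpace F] [IsNonarchimedeanLocalField F]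
  [CharZero F]
variable {M : Type u} [AddCommGroup M] [TopologicalSpace M] [DiscreteTopology M] [Finite M]

/-- **Right separation in local Tate duality `(2, 0)` at a finite level**: for a non-archimedean local
field `F` of characteristic `0` and a finite discrete `Γ_F`-module `M` killed by `p^k`, a NON-ZERO
invariant `f ∈ Hom_{Γ_F}(M, μ_{p^k})` is detected by a class: `H²(ev_f) z ≠ 0` for some `z ∈ H²(F, M)`
(the surjection `f ↦ ⟨·, f⟩ : Hom_{Γ_F}(M, μ_{p^k}) ↠ Hom(H²(F, M), ℤ/p^k)` of `twoZero_surjective_local` is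
a bijection by counting, `|Hom_{Γ_F}(M, μ_{p^k})| = |H²(F, M)| = |Hom(H²(F, M), ℤ/p^k)|`).
[cite: SerreGaloisCohomology1997, II §5.2 Thm. 2] [cite: MilneADT2006, I Cor. 2.3] -/
theorem _root_.Literature.NumberTheory.GaloisRepresentations.ContinuousRep.exists_cohomologyMap_two_ne_zero_of_ne_zero
    {p k : ℕ} [hp : Fact p.Prime]
    (ρ : ContinuousRep (absoluteGaloisGroup F) ℤ M) (hM : ∀ m : M, p ^ k • m = 0)
    (f : HomCarrier M (MuCarrier F (p ^ k))) (hf : ∀ g, ρ.homRep (mu F (p ^ k)) g f = f) (hf0 : f ≠ 0) :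
    ∃ z : continuousCohomology 2 ρ.toTopRep,
      cohomologyMap ((ρ.evalPairing (mu F (p ^ k))).flip.leftHom f hf) 2 z ≠ 0 := by
  haveI := absoluteGaloisGroup_compactSpace F
  haveI : NeZero (p ^ k) := ⟨pow_ne_zero k hp.out.ne_zero⟩
  haveI : Finite (MuCarrier F (p ^ k)) := finite_muCarrier F (p ^ k)
  obtain ⟨ιF, hιF⟩ := exists_injective_iota_top F (p ^ k)
  have hH2n : ∀ z : continuousCohomology 2 ρ.toTopRep, (p ^ k) • z = 0 :=
    nsmul_continuousCohomology_two_eq_zero ρ.toTopRep (p ^ k) hM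
  obtain ⟨hfin, hcard⟩ := natCard_two_eq_natCard_invariants_homRep F ρ hM
  haveI := hfin
  haveI : Finite (continuousCohomology 2 ρ.toTopRep →+ ZMod (p ^ k)) :=
    .of_injective _ DFunLike.coe_injective
  by_contra hall
  push Not at hall
  -- `f ↦ ⟨·, f⟩` on the invariants
  let Φ : (ρ.homRep (mu F (p ^ k))).toTopRep.ρ.invariants →
      (continuousCohomology 2 ρ.toTopRep →+ ZMod (p ^ k)) :=
    fun w ↦ ρ.twoZero (mu F (p ^ k)) ιF w.1 w.2
  have hΦs : Surjective Φ := fun lam ↦ by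
    obtain ⟨g, hg, h⟩ := ContinuousRep.twoZero_surjective_local F ρ hM ιF hιF lam
    exact ⟨⟨g, hg⟩, h⟩
  have hcard' : Nat.card (ρ.homRep (mu F (p ^ k))).toTopRep.ρ.invariants =
      Nat.card (continuousCohomology 2 ρ.toTopRep →+ ZMod (p ^ k)) := by
    rw [Nat.card_addMonoidHom_zmod hH2n, hcard]
  obtain ⟨e⟩ := Finite.card_eq.1 hcard'
  have hΦi : Injective Φ := (Finite.injective_iff_surjective_of_equiv e).2 hΦs
  -- `Φ f = 0 = Φ 0`
  have hΦf : Φ ⟨f, hf⟩ = 0 := AddMonoidHom.ext fun z ↦ by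
    change ρ.twoZero (mu F (p ^ k)) ιF f hf z = 0
    rw [ContinuousRep.twoZero_apply, hall z, map_zero]
  have h0mem : (0 : HomCarrier M (MuCarrier F (p ^ k))) ∈
      (ρ.homRep (mu F (p ^ k))).toTopRep.ρ.invariants := Submodule.zero_mem _
  have hΦ0 : Φ ⟨0, h0mem⟩ = 0 := AddMonoidHom.ext fun z ↦ by
    change ρ.twoZero (mu F (p ^ k)) ιF 0 h0mem z = 0
    obtain ⟨c, rfl⟩ := twoCocycleClass_surjective _ z
    rw [ContinuousRep.twoZero_apply, cohomologyMap_twoCocycleClass]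
    convert (congrArg ιF (twoCocycleClass_zero (mu F (p ^ k)).toTopRep)).trans (map_zero ιF) using 3
    refine Subtype.ext (ContinuousMap.ext fun x ↦ ?_)
    rw [pullback₂_id_resIdHom_apply, ContPairing.leftHom_hom_apply]
    rfl
  have := hΦi (hΦf.trans hΦ0.symm)
  exact hf0 (congrArg Subtype.val this)

end Separation

/-! ### §3. The converse over `ℤ`: `H²(F, 𝒟) = 0` forces every equivariant `𝒟 → K̄ˣ` to vanish -/

/-- A finite `p`-primary abelian group is killed by a single power of `p` (private helper).
[folklore] -/
private theorem exists_pow_nsmul_eq_zero' {p : ℕ} [Fact p.Prime] (B : Type*) [AddCommGroup B]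
    [Finite B] (hB : IsPrimaryTorsion p B) : ∃ k : ℕ, ∀ b : B, p ^ k • b = 0 := by
  obtain ⟨m, hm⟩ := exists_card_eq_prime_pow B hB
  exact ⟨m, fun b => addOrderOf_dvd_iff_nsmul_eq_zero.1 (hm ▸ addOrderOf_dvd_natCard b)⟩

/-- **Transport of an equivariant `h : 𝒟 → K̄ˣ` to an invariant element of `Hom(W, μ_n(K̄_F))`** on a
stable level `W` killed by `n`: `h|_W` takes values in `μ_n(K̄) ≅ μ_n(K̄_F)` (`muOfUnit`,
`muTransferEquiv`), and equivariance for `Γ_F → Γ_K` becomes invariance under `homRep`.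
[cite: Greenberg2006, §5 A (p. 372 L93 – p. 373 L10)] -/
theorem exists_homCarrier_of_equivariant (K F : Type u) [Field K] [CharZero K] [Field F]
    [Algebra K F] [CharZero F] {D : Type u} [AddCommGroup D] [TopologicalSpace D] [DiscreteTopology D]
    (ρ : ContinuousRep (absoluteGaloisGroup F) ℤ D) (h : D →+ UnitsCarrier K)
    (hequiv : ∀ (σ : absoluteGaloisGroup F) (d : D),
      h (ρ σ d) = units K (absGaloisRestrict K F σ) (h d))
    (W : Submodule ℤ D) (hW : ∀ g, W ≤ W.comap (ρ g)) [Finite W] (n : ℕ) [NeZero n]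
    (hn : ∀ w : W, n • w = 0) :
    ∃ (f : HomCarrier W (MuCarrier F n)) (_ : ∀ g, (ρ.subrepresentation W hW).homRep (mu F n) g f = f),
      ∀ w : W, kummerInclAddHom K n ((muTransferEquiv K F n).symm (f w)) = h w := by
  have hpow : ∀ w : W, unitsVal K (h w) ^ n = 1 := fun w ↦ by
    rw [← unitsVal_nsmul, ← map_nsmul]
    change unitsVal K (h ((n • w : W) : D)) = 1
    rw [hn w, Submodule.coe_zero, map_zero]
    rfl
  let g : W →+ MuCarrier K n :=
    { toFun := fun w ↦ muOfUnit K n (unitsVal K (h w)) (hpow w)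
      map_zero' := muVal_injective K n (by
        rw [muVal_muOfUnit, muVal_zero, Submodule.coe_zero, map_zero]; rfl)
      map_add' := fun v w ↦ muVal_injective K n (by
        rw [muVal_muOfUnit, muVal_add, muVal_muOfUnit, muVal_muOfUnit, Submodule.coe_add, map_add,
          unitsVal_add]) }
  have hg : ∀ w : W, muVal K n (g w) = unitsVal K (h w) := fun w ↦
    muVal_muOfUnit K n (unitsVal K (h w)) (hpow w)
  let e := muTransferEquiv K F n
  let f : HomCarrier W (MuCarrier F n) := HomCarrier.ofAddMonoidHom (e.toAddMonoidHom.comp g)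
  have hf_apply : ∀ w : W, f w = e (g w) := fun _ ↦ rfl
  have hf : ∀ σ, (ρ.subrepresentation W hW).homRep (mu F n) σ f = f := fun σ ↦
    (ContinuousRep.homRep_apply_eq_self_iff _ _ σ f).2 fun w ↦ by
      rw [hf_apply, hf_apply]
      change mu F n σ (muTransfer K F n (g w)) = muTransfer K F n (g _)
      rw [← muTransfer_mu]
      congr 1
      apply muVal_injective K n
      rw [muVal_apply, hg, hg]
      change _ = unitsVal K (h (ρ σ w))
      rw [hequiv, unitsVal_apply]
  refine ⟨f, hf, fun w ↦ ?_⟩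
  apply unitsVal_injective K
  rw [unitsVal_kummerInclAddHom, hf_apply, AddEquiv.symm_apply_apply, hg]

/-- **`H²(F, 𝒟) = 0 ⟹` every `Γ_F`-equivariant additive `𝒟 → K̄ˣ` vanishes**, over `ℤ`: `F` a
non-archimedean local field of characteristic `0` given as a `K`-algebra (`K` of characteristic `0`,
e.g. the number field of which `F` is a completion), `𝒟` a discrete `p`-primary `Γ_F`-module with
`H²(F, 𝒟) = 0`. This is the half "`(T*)^{G_{K_v}} ≠ 0 ⟹ H²(K_v, 𝒟) ≠ 0`" of the duality
"`H²(K_v, 𝒟)` is Pontryagin dual to `(T*)^{G_{K_v}}`"; see the module docstring for the finite-level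
proof. [cite: Greenberg2006, §5 A (p. 372 L93 – p. 373 L10)] [cite: MilneADT2006, I Cor. 2.3] -/
theorem equivariantHom_eq_zero_of_subsingleton_H_two (K F : Type u) [Field K] [CharZero K] [Field F]
    [Algebra K F] [ValuativeRel F] [TopologicalSpace F] [IsNonarchimedeanLocalField F] [CharZero F]
    {p : ℕ} [hp : Fact p.Prime] {D : Type u} [AddCommGroup D] [TopologicalSpace D] [DiscreteTopology D]
    (ρ : ContinuousRep (absoluteGaloisGroup F) ℤ D) (hD : IsPrimaryTorsion p D)
    (hH2 : Subsingleton (continuousCohomology 2 ρ.toTopRep))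
    (h : D →+ UnitsCarrier K)
    (hequiv : ∀ (σ : absoluteGaloisGroup F) (d : D),
      h (ρ σ d) = units K (absGaloisRestrict K F σ) (h d)) :
    h = 0 := by
  haveI := absoluteGaloisGroup_compactSpace F
  have hp0 : p ≠ 0 := hp.out.ne_zero
  refine AddMonoidHom.ext fun a ↦ ?_
  -- the finite stable level generated by `a`
  let W : Submodule ℤ D := genSubmodule ρ {a}
  have hW : ∀ g, W ≤ W.comap (ρ g) := genSubmodule_le_comap ρ _
  have haW : a ∈ W := subset_genSubmodule ρ _ (Set.mem_singleton a)
  haveI hWfin : Finite W := finite_genSubmodule ρ hp0 hD (Set.finite_singleton a)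
  obtain ⟨k₀, hk₀⟩ := exists_pow_nsmul_eq_zero' (p := p) W (hD.submodule W)
  -- every class of `H²(Γ, W)` dies at some finite level `W_z ⊇ W`
  have hdie : ∀ z : continuousCohomology 2 (ρ.subrepresentation W hW).toTopRep,
      ∃ (Wz : Submodule ℤ D) (hWz : ∀ g, Wz ≤ Wz.comap (ρ g)) (_ : W ≤ Wz), Finite Wz ∧
        ∀ (W' : Submodule ℤ D) (hW' : ∀ g, W' ≤ W'.comap (ρ g)) (_ : Wz ≤ W')
          (φ : (ρ.subrepresentation W hW).toTopRep ⟶ (ρ.subrepresentation W' hW').toTopRep),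
          (∀ w : W, (φ.hom w : D) = w) → cohomologyMap φ 2 z = 0 := by
    intro z
    obtain ⟨c₁, rfl⟩ := twoCocycleClass_surjective _ z
    have h0 : cohomologyMap (subtypeHom ρ W hW) 2 (twoCocycleClass _ c₁) = 0 := Subsingleton.elim _ _
    obtain ⟨Wz, hWz, hle, c, hfinz, hc, hc0⟩ :=
      exists_level_twoCocycleClass_eq_zero ρ hp0 hD hW (Set.toFinite _) c₁ h0
    refine ⟨Wz, hWz, hle, hfinz, fun W' hW' hle' φ hφ ↦ ?_⟩
    -- `c₁` pushed to `W'` is `c` pushed to `W'`, whose class is the image of `[c] = 0`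
    obtain ⟨ψ, hψ⟩ := ρ.exists_inclusionHom hWz hW' hle'
    obtain ⟨c', hc'⟩ := contTwoCocycles.exists_codRestrict ρ
      (contTwoCocycles.pullback (ContinuousMonoidHom.id _) (resIdHom (subtypeHom ρ W hW)) c₁) W' hW'
      fun x ↦ by
        obtain ⟨σ, τ⟩ := x
        rw [pullback₂_id_resIdHom_apply, subtypeHom_hom_apply]
        exact hle' (hle (c₁.1 (σ, τ)).2)
    have hc'' : ∀ x, (c'.1 x : D) = (c₁.1 x : D) := fun x ↦ by
      obtain ⟨σ, τ⟩ := x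
      rw [hc' (σ, τ), pullback₂_id_resIdHom_apply, subtypeHom_hom_apply]
    rw [cohomologyMap_eq_of_coe_eq ρ φ hφ c₁ c' (fun x ↦ (hc'' x).symm),
      ← cohomologyMap_eq_of_coe_eq ρ ψ hψ c c' (fun x ↦ (hc x).trans (hc'' x).symm), hc0, map_zero]
  choose Wz hWz hleWz hfinWz hkill using hdie
  -- a common finite stable level `W'`
  haveI : Finite (continuousCohomology 2 (ρ.subrepresentation W hW).toTopRep) := by
    letI : ValuativeRel F := inferInstance
    exact (natCard_two_eq_natCard_invariants_homRep F (ρ.subrepresentation W hW) hk₀).1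
  let W' : Submodule ℤ D := genSubmodule ρ (⋃ z, (Wz z : Set D))
  have hW' : ∀ g, W' ≤ W'.comap (ρ g) := genSubmodule_le_comap ρ _
  have hleW' : ∀ z, Wz z ≤ W' := fun z x hx ↦ subset_genSubmodule ρ _ (Set.mem_iUnion.2 ⟨z, hx⟩)
  have hWW' : W ≤ W' := by
    obtain ⟨z⟩ : Nonempty (continuousCohomology 2 (ρ.subrepresentation W hW).toTopRep) := ⟨0⟩
    exact (hleWz z).trans (hleW' z)
  haveI hW'fin : Finite W' := by
    refine finite_genSubmodule ρ hp0 hD (Set.finite_iUnion fun z ↦ ?_)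
    haveI := hfinWz z
    exact Set.toFinite _
  obtain ⟨k, hk⟩ := exists_pow_nsmul_eq_zero' (p := p) W' (hD.submodule W')
  haveI : NeZero (p ^ k) := ⟨pow_ne_zero k hp0⟩
  have hkW : ∀ w : W, p ^ k • w = 0 := fun w ↦ Subtype.ext (by
    have := congrArg Subtype.val (hk ⟨(w : D), hWW' w.2⟩)
    simpa using this)
  -- transports of `h` to the levels `W'` and `W`
  obtain ⟨f', hf', hf'h⟩ := exists_homCarrier_of_equivariant K F ρ h hequiv W' hW' (p ^ k) hk
  obtain ⟨f, hf, hfh⟩ := exists_homCarrier_of_equivariant K F ρ h hequiv W hW (p ^ k) hkW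
  obtain ⟨φ, hφ⟩ := ρ.exists_inclusionHom hW hW' hWW'
  have hff' : ∀ w : W, f w = f' ⟨w, hWW' w.2⟩ := fun w ↦ by
    have e1 := (hfh w).trans (hf'h ⟨w, hWW' w.2⟩).symm
    have e2 : (muTransferEquiv K F (p ^ k)).symm (f w) =
        (muTransferEquiv K F (p ^ k)).symm (f' ⟨w, hWW' w.2⟩) := by
      apply muVal_injective K (p ^ k)
      rw [← unitsVal_kummerInclAddHom, ← unitsVal_kummerInclAddHom, e1]
    exact (muTransferEquiv K F (p ^ k)).symm.injective e2
  -- `f = 0` by right separation at level `W`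
  have hf0 : f = 0 := by
    by_contra hne
    obtain ⟨z, hz⟩ := ContinuousRep.exists_cohomologyMap_two_ne_zero_of_ne_zero F
      (ρ.subrepresentation W hW) hkW f hf hne
    apply hz
    -- `H²(ev_f) z = H²(ev_{f'}) (H²(φ) z) = 0`
    obtain ⟨c, rfl⟩ := twoCocycleClass_surjective _ z
    have hφz := hkill (twoCocycleClass _ c) W' hW' (hleW' _) φ hφ
    obtain ⟨c', hc'⟩ := contTwoCocycles.exists_codRestrict ρ
      (contTwoCocycles.pullback (ContinuousMonoidHom.id _) (resIdHom (subtypeHom ρ W hW)) c) W' hW'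
      fun x ↦ by
        obtain ⟨σ, τ⟩ := x
        rw [pullback₂_id_resIdHom_apply, subtypeHom_hom_apply]
        exact hWW' (c.1 (σ, τ)).2
    have hc'' : ∀ x, (c'.1 x : D) = (c.1 x : D) := fun x ↦ by
      obtain ⟨σ, τ⟩ := x
      rw [hc' (σ, τ), pullback₂_id_resIdHom_apply, subtypeHom_hom_apply]
    have e1 : cohomologyMap (((ρ.subrepresentation W hW).evalPairing (mu F (p ^ k))).flip.leftHom f hf) 2
          (twoCocycleClass _ c) =
        cohomologyMap (((ρ.subrepresentation W' hW').evalPairing (mu F (p ^ k))).flip.leftHom f' hf') 2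
          (twoCocycleClass _ c') := by
      rw [cohomologyMap_twoCocycleClass, cohomologyMap_twoCocycleClass]
      refine congrArg _ (Subtype.ext (ContinuousMap.ext fun x ↦ ?_))
      obtain ⟨σ, τ⟩ := x
      rw [pullback₂_id_resIdHom_apply, pullback₂_id_resIdHom_apply, ContPairing.leftHom_hom_apply,
        ContPairing.leftHom_hom_apply]
      change f (c.1 (σ, τ)) = f' (c'.1 (σ, τ))
      rw [hff']
      congr 1
      exact Subtype.ext (hc'' (σ, τ)).symm
    rw [e1, ← cohomologyMap_eq_of_coe_eq ρ φ hφ c c' (fun x ↦ (hc'' x).symm), hφz, map_zero]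
  -- hence `h a = 1`
  have := hfh ⟨a, haW⟩
  rw [hf0, HomCarrier.zero_apply, map_zero, map_zero] at this
  exact this.symm

/-! ### §4. The Greenberg-typed statement -/

/-- **Greenberg 2006, §5 A, converse of the consumed implication**: for every `p`, number field `K`,
set `S`, coefficient ring `Λ`, discrete `p`-primary `𝒟` with a continuous `Λ`-linear action of
`G_{K,S}`, and finite place `v`: if `H²(K_v, 𝒟) = 0` then LOC_v⁽¹⁾(𝒟) holds (every `Γ_{K_v}`-equivariant
additive `𝒟 → K̄ˣ` is zero). With `sec5A_localH2_subsingleton_of_LOC1_holds`: LOC_v⁽¹⁾(𝒟) ⟺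
`H²(K_v, 𝒟) = 0`. [cite: Greenberg2006, §5 A (p. 372 L93 – p. 373 L10; p. 373 L44–45)] -/
theorem loc1_of_subsingleton_localH2 {p : ℕ} [Fact p.Prime] {K : Type} [Field K] [NumberField K]
    (S : Set (HeightOneSpectrum (𝓞 K))) {Λ : Type} [CommRing Λ] [TopologicalSpace Λ]
    {D : Type} [AddCommGroup D] [Module Λ D] [TopologicalSpace D] [DiscreteTopology D]
    [ContinuousSMul Λ D] (ρ : ContinuousRep (GaloisGroupUnramifiedOutside K S) Λ D)
    (hpD : ∀ d : D, ∃ n : ℕ, (p ^ n : ℤ) • d = 0) (v : HeightOneSpectrum (𝓞 K))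
    (hH2 : Subsingleton ((localRep S ρ (Sum.inr v)).H 2)) : LOC1 S ρ (Sum.inr v) := by
  -- the local field `K_v`
  letI : ValuativeRel (NumberField.Place.Completion (Sum.inr v : NumberField.Place K)) :=
    inferInstanceAs (ValuativeRel (v.adicCompletion K))
  letI : TopologicalSpace (NumberField.Place.Completion (Sum.inr v : NumberField.Place K)) :=
    inferInstanceAs (TopologicalSpace (v.adicCompletion K))
  haveI : IsNonarchimedeanLocalField (NumberField.Place.Completion (Sum.inr v : NumberField.Place K)) :=
    inferInstanceAs (IsNonarchimedeanLocalField (v.adicCompletion K))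
  haveI : CharZero (NumberField.Place.Completion (Sum.inr v : NumberField.Place K)) :=
    charZero_of_injective_algebraMap
      (algebraMap K (NumberField.Place.Completion (Sum.inr v : NumberField.Place K))).injective
  have hD : IsPrimaryTorsion p D := fun d => by
    obtain ⟨n, hn⟩ := hpD d
    refine ⟨n, ?_⟩
    rw [← natCast_zsmul, Nat.cast_pow]
    exact hn
  have hH2' : Subsingleton (continuousCohomology 2 ((localRep S ρ (Sum.inr v)).restrictScalars ℤ).toTopRep) := by
    change Subsingleton (((localRep S ρ (Sum.inr v)).restrictScalars ℤ).H 2)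
    exact (ContinuousRep.subsingleton_H_two_restrictScalars_iff ℤ (localRep S ρ (Sum.inr v))).2 hH2
  intro f hf
  exact equivariantHom_eq_zero_of_subsingleton_H_two K
    (NumberField.Place.Completion (Sum.inr v : NumberField.Place K))
    ((localRep S ρ (Sum.inr v)).restrictScalars ℤ) hD hH2' f hf

end Literature.NumberTheory.IwasawaTheory.Greenberg2006

end
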